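import Summits.Ventures.CertifiedManyBodySolver.Certificates.HubbardSquare_kdwidth_NM331Av3_T
import Summits.Ventures.CertifiedManyBodySolver.Certificates.HubbardSquare_transportClosureCells_M331w0_A
import HarnessLib

/-!
# Ventures/CertifiedManyBodySolver — Certificates/HubbardSquare_kdwidth_NM331Av3_H3.lean (hubbard-box-p2 g20: KD-WIDTH v3 NM331Av3, bridging lemmas part 3 of 3)

Per-word bridging: each cited landed word (its premises supplied from the bundle `kdw_NM331Av3_Premises`) ⇒ `WordRec.Holds e₀` of its
record in `HubbardSquare_kdwidth_NM331Av3_T*`. Proof shape: the record's corner functions equal the word's literal box (`fin_cases; norm_num`), apply the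
word, `norm_num [record, mlEval_vec8]` on both sides, `linarith`. WHAT THIS IS NOT: a new word.
-/

noncomputable section

namespace Summit.Ventures.CertifiedManyBodySolver.Certificates

open Literature.MathematicalPhysics.QuantumLattice Literature.MathematicalPhysics.QuantumLattice.ThermodynamicLimit
open Literature.MathematicalPhysics.QuantumLattice
open Literature.MathematicalPhysics.QuantumLattice.ThermodynamicLimit
open Literature.MathematicalPhysics.QuantumLattice.TTPrimeFree
open Literature.Probability.LatticeModels
open Matrix Finset Filter Topology
open Literature.Computation.Certificates.BoxCovering
open Literature.Analysis.ValidatedNumerics (KdCert)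

/-- Word 69 holds for `e₀`: the landed theorem `tcc_M331w0_c03_nchord_mlword_Icc`. -/
theorem kdw_NM331Av3_w69_holds (H : kdw_NM331Av3_Premises) : kdw_NM331Av3_w69.Holds (fun θ : Fin 3 → ℝ => energyDensityTT' 1 (θ 1) (θ 0) (θ 2)) := by
  intro θ hθ
  have eL : (fun k : Fin 3 => ((kdw_NM331Av3_w69.lo k : ℚ) : ℝ)) = (![13/2, -13/40, 5047/8000] : Fin 3 → ℝ) := by funext k; fin_cases k <;> norm_num [kdw_NM331Av3_w69]
  have eH : (fun k : Fin 3 => ((kdw_NM331Av3_w69.hi k : ℚ) : ℝ)) = (![279/40, -97/320, 5457/8000] : Fin 3 → ℝ) := by funext k; fin_cases k <;> norm_num [kdw_NM331Av3_w69]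
  have hw := Summit.Ventures.CertifiedManyBodySolver.Certificates.tcc_M331w0_c03_nchord_mlword_Icc H.hsX5m20 H.hsX8m35n70 H.hsX17o2m20 H.hsX12m20 H.hsX7o2m30 H.hVB4 H.hsX7o2m40 H.h517t H.hVB3 θ (by rw [← eL, ← eH]; exact hθ)
  constructor
  · have h := hw.1; norm_num [kdw_NM331Av3_w69, mlEval_vec8] at h ⊢; linarith
  · have h := hw.2; norm_num [kdw_NM331Av3_w69, mlEval_vec8] at h ⊢; linarith

end Summit.Ventures.CertifiedManyBodySolver.Certificates

end
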